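import Mathlib.GroupTheory.Perm.Cycle.Type
import Literature.Barriers.ValiantsHypothesis.GKKP11CharacteristicTwo
import Literature.Computability.AlgebraicComplexity.LayeredABPInvRepr
import Literature.Computability.AlgebraicComplexity.SkewCircuitAffineSubstitution
import Literature.Computability.AlgebraicComplexity.BLMW11WeaklySkewToSkewProofs
import Literature.Computability.AlgebraicComplexity.DeterminantalConormalBoundKernelAlgebra
import Literature.Computability.AlgebraicComplexity.BLMW11FormulasWeaklySkew
import HarnessLib

/-!
# The partial permanent is in `VP_ws` in characteristic 2 (Malod 2011; Mengel via Valiant's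
# Pfaffian Sum theorem) — GKKP 2011 §5, postscript; Bürgisser's Problem 3.1 settled — PROVED

B. Grenet, E. L. Kaltofen, P. Koiran, N. Portier, *Symmetric determinantal representation of
formulas and weakly skew circuits*, Contemp. Math. **556** (2011) = arXiv:1007.3804v3, end of §5
(held text `paper:arxiv-1007.3804`, p0021:L25): "Since the submission of this paper, Bürgisser's
open problem has been completely settled. Guillaume Malod [Mal11] has proved, using clow sequences
à la Mahajan and Vinay [MV97], that `PER* ∈ VP_ws`. Stefan Mengel subsequently noticed that the
result can be derived from a result of Valiant on Pfaffian Sums [Val02], see also [GLV11]."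
([Mal11] = G. Malod, *Computing the partial permanent in characteristic 2*, unpublished manuscript,
2011, p0023:L43; the open problem is Bürgisser 2000, Problem 3.1: is the partial permanent
`VNP`-complete in characteristic `2`?)

Companion of `GKKP11CharacteristicTwo.lean` (cell `val-lit`, DAG row GKKP11-B, which types §5:
`Matrix.partialPermanent` = GKKP Def. 8, `partialPerPoly`, Lemma 8, Thm. 8 "`(PER*)² ∈ VP_ws`",
Cor. 1 "`PER*` `VNP`-complete ⇒ `VNP² ⊆ VP_ws`", and records the postscript as "not held, not
typed"). This file PROVES the postscript's theorem in the kernel, by Mengel's route made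
elementary, over every commutative ring of characteristic `2`; no named facts are introduced.

**Why barrier-side.** `PER*` was Bürgisser's candidate for a `VNP`-complete family in
characteristic `2` (where `PER = DET` collapses the permanent, tree:
`Literature.Barriers.ValiantsHypothesis.CharacteristicTwo`). The theorem says the candidate is
EASY: `PER* ∈ VP_ws`, so it is `VNP`-complete only if every `VNP` family is a `p`-projection of
the determinant (`isPProjection_detPoly_of_isVNPComplete_partialPerPoly`, Cor. 1 without the
square).

## The proof formalised here (Mengel's remark, in characteristic `2` all signs disappear)

1. **Involution expansion of a Pfaffian (§1).** For a weight matrix `W` on `[N]`, `N` even, and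
   `U` the all-ones matrix off the diagonal, in characteristic `2`
   `pf (W + U) = Σ_{σ involution of [N]} ∏_{i < σ i} W_{i σ(i)}` — the sum over ALL matchings of
   `[N]` (perfect or not) of the products of the matched weights (`pfaffian_of_add_one`; the
   Pfaffian is the tree's `Literature.LinearAlgebra.Matrix.pfaffian`, Laplace-type expansion along
   the first row). Proof by that expansion: the matchings with `0` matched to `j+1` are the
   `swap 0 (j+1) ∘ ext_j τ` (`τ` a matching of the minor), and the constant terms `1 · pf(minor_j)`
   produce each matching with `0` unmatched once for every other unmatched vertex — an odd number
   of times, since an involution of an even set has an even number of fixed points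
   (`Equiv.Perm.card_compl_support_modEq`). This is the characteristic-`2` shadow of Valiant's
   Pfaffian Sum theorem [Val02] (`PfSum_Θ(λ) = pf(Θ + Λ(λ))`, all `λᵢ = 1`, the multiplicities
   being the odd double factorials `(N − 2|μ| − 1)!!`).
2. **Bipartite specialization (§2).** For `B ∈ R^{n×n}` let `malodMatrix B` be the symmetric
   zero-diagonal `2n × 2n` matrix `[[J−I, B+J], [Bᵀ+J, J−I]]` (rows of `K_{n,n}` first). The
   matchings of `K_{2n}` of non-zero weight in `[[0,B],[Bᵀ,0]]` are the partial matchings of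
   `K_{n,n}` = graphs of injective partial maps (GKKP Lemma 7; the bijection `toPartial`/`ofPartial`
   of `GKKP2011Lemma8` is reused), so **`pf (malodMatrix B) = per* B`** (`pfaffian_malodMatrix`).
3. **Branching program and determinant (§3).** In characteristic `2`, `malodMatrix (X_{ij})` is
   alternating with affine entries, so the layered Pfaffian program of
   `PfaffianLayeredABP.lean` (`PfaffianABP.layeredABPComputes_of_alternating`, `2(t+2)³` vertices,
   [MSV04, Thm. 12] class) computes `PER*_{n+1}` with `2(n+2)³` vertices
   (`layeredABPComputes_partialPerPoly_succ_of_charTwo`); by `LayeredABPInvRepr.lean`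
   (`LayeredABPComputes.hasDetRepr`) **`dc(PER*_n) ≤ 2(n+1)³ + 1`**
   (`hasDetRepr_partialPerPoly_of_charTwo`, `determinantalComplexity_partialPerPoly_le_of_charTwo`).
4. **`VP_ws` (§3).** An affine determinantal representation of size `N` gives
   `L_ws ≤ ((N+2)(4N³+7)² + N²)(2·#vars + 3)` over every commutative ring
   (`wsComplexity_le_of_hasDetRepr_commRing`, the tree's `wsComplexity_le_of_hasDetRepr` being the
   case `ℂ`: affine substitution into the tree's skew determinant circuit,
   `wsComplexity_aeval_affine_le`), whence **`(PER*_n) ∈ VP_ws`**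
   (`isVPwsFamily_partialPerPoly_of_charTwo`, the tree's `IsVPwsFamily` of BLMW 2011 §9.1 —
   well-formed fan-in-two weakly-skew circuits, erratum A14 form), and, in the rendering of
   `VP_ws` used by `GKKP11CharacteristicTwo.lean` (Malod–Portier: `VP_ws` = `p`-projections of
   `DET`), **`(PER*_n)` is a `p`-projection of `(DET_n)`**
   (`isPProjection_partialPerPoly_detPoly_of_charTwo`, via `skewComplexity_le_four_mul_wsComplexity`
   and `isProjection_detPoly_of_isSkew`).

Definitions are proof plumbing only (`involWeight`, `invols`, `matchingSum`, `emb`, `Away`,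
`embEquiv`, `ext`, `res`, `vx`, `malodMatrix`); no `instance`, no notation, no named fact
(D-0026: net debt `0`). Honest framing: a kernel replay of a KNOWN 2011 result about an EASY
family in characteristic `2`; `VP ≠ VNP` is NOT proved and nothing here is progress on it.
Cell `val-lit`, seat t16 g5.

## References

* [GrenetEtAl2011] Grenet–Kaltofen–Koiran–Portier, Contemp. Math. 556 (2011) = arXiv:1007.3804,
  §5.2 (Def. 8, Lemma 7) and the postscript of §5 (p0021:L25; [Mal11] = p0023:L43).
* [Valiant2002] L. G. Valiant, *Quantum circuits that can be simulated classically in polynomial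
  time*, SIAM J. Comput. 31 (2002) 1229–1254 (Pfaffian Sum theorem; GKKP's [Val02]; paywalled,
  acquisition want filed — cited through GKKP's postscript only).
* [Burgisser2000] P. Bürgisser, *Completeness and Reduction in Algebraic Complexity Theory*,
  Springer 2000, Problem 3.1 (partial permanent).
* [MahajanSubramanyaVinay2004] Mahajan–Subramanya–Vinay, Discrete Appl. Math. 143 (2004), Thm. 12
  (branching programs for the Pfaffian).
* [BurgisserEtAl2011] Bürgisser–Landsberg–Manivel–Weyman, SIAM J. Comput. 40 (2011), §9.1–§9.2
  (`L_ws`, `VP_ws`, universality of the determinant).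
* [MalodPortier2008] G. Malod, N. Portier, J. Complexity 24 (2008) (`VP_ws` and `p`-projections
  of `DET`).
-/

noncomputable section

namespace Literature.Barriers.ValiantsHypothesis

namespace PartialPermanentCharTwo

open Finset Equiv
open scoped Matrix
open Literature.LinearAlgebra.Matrix (pfaffian pfMinor pfaffian_fin_add_two pfaffian_congr)

universe u

variable {R : Type u} [CommRing R]

/-! ### Involutions of `Fin N` and their weights -/

/-- The weight of a permutation `σ` of `Fin N` in the weight matrix `W`: the product of the
entries `W i (σ i)` over the positions `i < σ i`. For an involution `σ` (a matching of `[N]` with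
the fixed points unmatched) this is the product of the weights `W a b` (`a < b`) of its `2`-cycles.
Proof plumbing for `pfaffian_of_add_one`. [folklore] -/
def involWeight {N : ℕ} (W : Matrix (Fin N) (Fin N) R) (σ : Perm (Fin N)) : R :=
  ∏ i, if i < σ i then W i (σ i) else 1

/-- The involutions of `Fin N` (`σ ∘ σ = id`), as a `Finset`. [folklore] -/
def invols (N : ℕ) : Finset (Perm (Fin N)) := univ.filter fun σ => ∀ x, σ (σ x) = x

/-- The all-matchings sum of the weight matrix `W` on `Fin N`: `Σ_{σ involution} involWeight W σ`
(every matching of `[N]`, perfect or not, contributes the product of the weights of its edges).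
[folklore] -/
def matchingSum {N : ℕ} (W : Matrix (Fin N) (Fin N) R) : R :=
  ∑ σ ∈ invols N, involWeight W σ

/-- Membership in `invols`. [folklore] -/
private theorem mem_invols {N : ℕ} {σ : Perm (Fin N)} : σ ∈ invols N ↔ ∀ x, σ (σ x) = x := by
  simp [invols]

/-! ### Deleting the vertices `0` and `j+1`: the embedding `a ↦ (j.succAbove a).succ` -/

section Embedding

variable {n : ℕ} (j : Fin (n + 1))

/-- The increasing embedding `Fin n ↪ Fin (n+2)` missing `0` and `j.succ` (the index map of the
minor `pfMinor A j`). [folklore] -/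
private def emb (a : Fin n) : Fin (n + 2) := (j.succAbove a).succ

/-- Unfolding of `emb`. [folklore] -/
@[simp] private theorem emb_apply (a : Fin n) : emb j a = (j.succAbove a).succ := rfl

/-- `emb j` misses `0`. [folklore] -/
private theorem emb_ne_zero (a : Fin n) : emb j a ≠ 0 := Fin.succ_ne_zero _

/-- `emb j` misses `j.succ`. [folklore] -/
private theorem emb_ne_succ (a : Fin n) : emb j a ≠ j.succ := fun h =>
  Fin.succAbove_ne j a (Fin.succ_injective _ h)

/-- `emb j` is strictly increasing. [folklore] -/
private theorem emb_strictMono : StrictMono (emb (n := n) j) :=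
  Fin.strictMono_succ.comp (Fin.strictMono_succAbove j)

/-- `emb j` reflects and preserves `<`. [folklore] -/
private theorem emb_lt_emb_iff {a b : Fin n} : emb j a < emb j b ↔ a < b := (emb_strictMono j).lt_iff_lt

/-- `emb j` is injective. [folklore] -/
private theorem emb_injective : Function.Injective (emb (n := n) j) := (emb_strictMono j).injective

/-- The complement of `{0, j.succ}` (reducible, so that it is decidable by instance search).
[folklore] -/
private abbrev Away (x : Fin (n + 2)) : Prop := x ≠ 0 ∧ x ≠ j.succ

/-- The image of `emb j` avoids `0` and `j.succ`. [folklore] -/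
private theorem away_emb (a : Fin n) : Away j (emb j a) := ⟨emb_ne_zero j a, emb_ne_succ j a⟩

/-- Every index other than `0`, `j.succ` is in the image of `emb j`. [folklore] -/
private theorem exists_emb_eq {x : Fin (n + 2)} (hx : Away j x) : ∃ a, emb j a = x := by
  obtain ⟨y, rfl⟩ := (Fin.exists_succ_eq (x := x)).2 hx.1
  have hy : y ≠ j := fun h => hx.2 (by rw [h])
  obtain ⟨a, ha⟩ := Fin.exists_succAbove_eq hy
  exact ⟨a, by rw [emb_apply, ha]⟩

/-- `Fin n ≃ {x // x ≠ 0 ∧ x ≠ j.succ}` along `emb j`. [folklore] -/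
private def embEquiv : Fin n ≃ {x : Fin (n + 2) // Away j x} :=
  Equiv.ofBijective (fun a => ⟨emb j a, away_emb j a⟩)
    ⟨fun a b h => emb_injective j (congrArg Subtype.val h),
     fun ⟨x, hx⟩ => by
      obtain ⟨a, ha⟩ := exists_emb_eq j hx
      exact ⟨a, Subtype.ext ha⟩⟩

/-- Unfolding of `embEquiv`. [folklore] -/
@[simp] private theorem coe_embEquiv (a : Fin n) : (embEquiv j a : Fin (n + 2)) = emb j a := rfl

/-- `emb j` inverts `embEquiv j` on the subtype. [folklore] -/
private theorem embEquiv_symm_apply_coe (x : {x : Fin (n + 2) // Away j x}) :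
    emb j ((embEquiv j).symm x) = x := by
  have := congrArg Subtype.val ((embEquiv j).apply_symm_apply x)
  rw [coe_embEquiv] at this
  exact this

/-! ### Extending a permutation of `Fin n` along `emb j`, and restricting back -/

/-- The extension of `τ : Perm (Fin n)` to `Fin (n+2)` along `emb j`, fixing `0` and `j.succ`.
[folklore] -/
private def ext (τ : Perm (Fin n)) : Perm (Fin (n + 2)) := Perm.ofSubtype ((embEquiv j).permCongr τ)

/-- The extension acts as `τ` on the image of `emb j`. [folklore] -/
private theorem ext_emb (τ : Perm (Fin n)) (a : Fin n) : ext j τ (emb j a) = emb j (τ a) := by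
  rw [ext, Perm.ofSubtype_apply_of_mem _ (away_emb j a), Equiv.permCongr_apply]
  have h1 : (⟨emb j a, away_emb j a⟩ : {x // Away j x}) = embEquiv j a := rfl
  rw [h1, Equiv.symm_apply_apply]
  rfl

/-- The extension fixes `0` and `j.succ`. [folklore] -/
private theorem ext_of_not_away (τ : Perm (Fin n)) {x : Fin (n + 2)} (hx : ¬ Away j x) : ext j τ x = x :=
  Perm.ofSubtype_apply_of_not_mem _ hx

/-- The extension fixes `0`. [folklore] -/
@[simp] private theorem ext_zero (τ : Perm (Fin n)) : ext j τ 0 = 0 :=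
  ext_of_not_away j τ (by simp [Away])

/-- The extension fixes `j.succ`. [folklore] -/
@[simp] private theorem ext_succ (τ : Perm (Fin n)) : ext j τ j.succ = j.succ :=
  ext_of_not_away j τ (by simp [Away])

/-- The extension preserves the complement of `{0, j.succ}`. [folklore] -/
private theorem away_ext_iff (τ : Perm (Fin n)) (x : Fin (n + 2)) : Away j (ext j τ x) ↔ Away j x :=
  Perm.ofSubtype_apply_mem_iff_mem _ x

/-- The restriction of a permutation of `Fin (n+2)` preserving `{0, j.succ}ᶜ` to `Fin n` along
`emb j` (junk value `1` if it does not preserve it). [folklore] -/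
private def res (σ : Perm (Fin (n + 2))) : Perm (Fin n) :=
  if h : ∀ x, Away j (σ x) ↔ Away j x then (embEquiv j).permCongr.symm (σ.subtypePerm h) else 1

/-- The restriction acts as `σ` through `emb j`. [folklore] -/
private theorem emb_res {σ : Perm (Fin (n + 2))} (h : ∀ x, Away j (σ x) ↔ Away j x) (a : Fin n) :
    emb j (res j σ a) = σ (emb j a) := by
  rw [res, dif_pos h]
  have : (embEquiv j) (((embEquiv j).permCongr.symm (σ.subtypePerm h)) a) =
      (σ.subtypePerm h) (embEquiv j a) := by
    simp
  have := congrArg Subtype.val this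
  simp only [coe_embEquiv, Perm.subtypePerm_apply] at this
  exact this

/-- Restricting an extension gives back the permutation. [folklore] -/
private theorem res_ext (τ : Perm (Fin n)) : res j (ext j τ) = τ := by
  refine Equiv.ext fun a => emb_injective j ?_
  rw [emb_res j (away_ext_iff j τ), ext_emb]

/-- Extending the restriction of a permutation fixing `0`, `j.succ` gives it back. [folklore] -/
private theorem ext_res {σ : Perm (Fin (n + 2))} (h : ∀ x, Away j (σ x) ↔ Away j x)
    (h₂ : ∀ x, σ x ≠ x → Away j x) : ext j (res j σ) = σ := by
  rw [res, dif_pos h, ext, Equiv.apply_symm_apply, Perm.ofSubtype_subtypePerm h h₂]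

/-- `ext j τ` is an involution iff `τ` is. [folklore] -/
private theorem ext_invol_iff (τ : Perm (Fin n)) :
    (∀ x, ext j τ (ext j τ x) = x) ↔ ∀ a, τ (τ a) = a := by
  constructor
  · intro h a
    apply emb_injective j
    rw [← ext_emb, ← ext_emb, h]
  · intro h x
    by_cases hx : Away j x
    · obtain ⟨a, rfl⟩ := exists_emb_eq j hx
      rw [ext_emb, ext_emb, h]
    · rw [ext_of_not_away j τ hx, ext_of_not_away j τ hx]

/-! ### Weights under extension -/

/-- The weight of a permutation of `Fin (n+2)` split at `0`, `j.succ` and the image of `emb j`.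
[folklore] -/
private theorem involWeight_eq_mul (W : Matrix (Fin (n + 2)) (Fin (n + 2)) R) (σ : Perm (Fin (n + 2))) :
    involWeight W σ = (if (0 : Fin (n + 2)) < σ 0 then W 0 (σ 0) else 1) *
      ((if j.succ < σ j.succ then W j.succ (σ j.succ) else 1) *
        ∏ a : Fin n, if emb j a < σ (emb j a) then W (emb j a) (σ (emb j a)) else 1) := by
  rw [involWeight, Fin.prod_univ_succ, Fin.prod_univ_succAbove _ j]
  rfl

/-- If `σ` acts on the image of `emb j` as `τ`, the `emb`-part of its weight is the weight of `τ`
in the minor. [folklore] -/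
private theorem prod_emb_eq_involWeight (W : Matrix (Fin (n + 2)) (Fin (n + 2)) R)
    (σ : Perm (Fin (n + 2))) (τ : Perm (Fin n)) (hστ : ∀ a, σ (emb j a) = emb j (τ a)) :
    (∏ a : Fin n, if emb j a < σ (emb j a) then W (emb j a) (σ (emb j a)) else 1) =
      involWeight (W.submatrix (emb j) (emb j)) τ := by
  refine Finset.prod_congr rfl fun a _ => ?_
  simp only [hστ, emb_lt_emb_iff, Matrix.submatrix_apply]

/-- Weight of the extension fixing `0` and `j.succ`. [folklore] -/
private theorem involWeight_ext (W : Matrix (Fin (n + 2)) (Fin (n + 2)) R) (τ : Perm (Fin n)) :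
    involWeight W (ext j τ) = involWeight (W.submatrix (emb j) (emb j)) τ := by
  rw [involWeight_eq_mul j, ← prod_emb_eq_involWeight j W (ext j τ) τ (ext_emb j τ)]
  simp

/-- Weight of the extension matching `0` with `j.succ`. [folklore] -/
private theorem involWeight_swap_mul_ext (W : Matrix (Fin (n + 2)) (Fin (n + 2)) R) (τ : Perm (Fin n)) :
    involWeight W (swap 0 j.succ * ext j τ) =
      W 0 j.succ * involWeight (W.submatrix (emb j) (emb j)) τ := by
  have h0 : (swap 0 j.succ * ext j τ) 0 = j.succ := by simp [Perm.mul_apply]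
  have hj : (swap 0 j.succ * ext j τ) j.succ = 0 := by simp [Perm.mul_apply]
  have ha : ∀ a, (swap 0 j.succ * ext j τ) (emb j a) = emb j (τ a) := by
    intro a
    rw [Perm.mul_apply, ext_emb, swap_apply_of_ne_of_ne (emb_ne_zero j _) (emb_ne_succ j _)]
  rw [involWeight_eq_mul j, prod_emb_eq_involWeight j W _ τ ha, h0, hj]
  simp [Fin.succ_pos]

/-- `swap 0 j.succ * ext j τ` is an involution iff `τ` is. [folklore] -/
private theorem swap_mul_ext_invol_iff (τ : Perm (Fin n)) :
    (∀ x, (swap 0 j.succ * ext j τ) ((swap 0 j.succ * ext j τ) x) = x) ↔ ∀ a, τ (τ a) = a := by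
  have h0 : (swap 0 j.succ * ext j τ) 0 = j.succ := by simp [Perm.mul_apply]
  have hj : (swap 0 j.succ * ext j τ) j.succ = 0 := by simp [Perm.mul_apply]
  have ha : ∀ a, (swap 0 j.succ * ext j τ) (emb j a) = emb j (τ a) := by
    intro a
    rw [Perm.mul_apply, ext_emb, swap_apply_of_ne_of_ne (emb_ne_zero j _) (emb_ne_succ j _)]
  constructor
  · intro h a
    apply emb_injective j
    rw [← ha, ← ha, h]
  · intro h x
    by_cases hx : Away j x
    · obtain ⟨a, rfl⟩ := exists_emb_eq j hx
      rw [ha, ha, h]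
    · simp only [Away, not_and_or, not_not] at hx
      rcases hx with rfl | rfl
      · rw [h0, hj]
      · rw [hj, h0]

end Embedding

/-! ### The expansion -/

/-- In characteristic `2` an odd natural number is `1`. [folklore] -/
private theorem natCast_eq_one_of_odd [CharP R 2] {c : ℕ} (hc : Odd c) : (c : R) = 1 := by
  obtain ⟨k, rfl⟩ := hc
  push_cast
  rw [CharTwo.two_eq_zero, zero_mul, zero_add]

/-- For an involution `σ` of `Fin (n+2)` fixing `0`, the number of `j : Fin (n+1)` with
`σ j.succ = j.succ` (the other fixed points) is odd: the fixed points of an involution of an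
even set are even in number. [folklore] -/
private theorem odd_card_fixed_succ {n : ℕ} (hn : Even n) (σ : Perm (Fin (n + 2)))
    (hσ : ∀ x, σ (σ x) = x) (h0 : σ 0 = 0) :
    Odd (univ.filter fun j : Fin (n + 1) => σ j.succ = j.succ).card := by
  classical
  -- fixed points of `σ` counted over `Fin (n+2)` = `1 +` those among the successors
  have hsq : σ ^ 2 ^ 1 = 1 := by
    ext x
    simp [pow_succ, Perm.mul_apply, hσ x]
  have hmod := Perm.card_compl_support_modEq hsq
  have hcompl : σ.supportᶜ = univ.filter fun x : Fin (n + 2) => σ x = x := by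
    ext x
    simp [Perm.mem_support]
  rw [hcompl, Fintype.card_fin] at hmod
  have hsplit : (univ.filter fun x : Fin (n + 2) => σ x = x).card =
      1 + (univ.filter fun j : Fin (n + 1) => σ j.succ = j.succ).card := by
    rw [Finset.card_filter, Finset.card_filter, Fin.sum_univ_succ, if_pos h0]
  rw [hsplit] at hmod
  -- `1 + c ≡ n + 2 (mod 2)` with `n` even forces `c` odd
  rw [Nat.odd_iff]
  unfold Nat.ModEq at hmod
  obtain ⟨m, rfl⟩ := hn
  omega

/-- **The characteristic-2 expansion of the Pfaffian of `W + U`** (`U` = all ones off the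
diagonal): for `N` even and any `W`, `pf (W i j + 1)_{i,j} = Σ_{σ involution of [N]} ∏_{i < σ i} W i (σ i)`
— the sum over ALL matchings of `[N]` of the products of the matched weights. Proof: expand along
vertex `0` (`pfaffian_fin_add_two`); the matchings in which `0` is matched with `j+1` are the
`τ ↦ swap 0 (j+1) ∘ ext_j τ`, and those in which `0` is unmatched arise from the constant term,
each one `#(other fixed points)` times — an odd number. The characteristic-`2` case (all `λᵢ = 1`,
signs dropped) of Valiant's Pfaffian Sum theorem [Val02], the result through which "Mengel noticed that
[`PER* ∈ VP_ws`] can be derived". [cite: GrenetEtAl2011, §5 postscript p0021:L25 (Mengel via [Val02], Pfaffian Sums)] -/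
theorem pfaffian_of_add_one [CharP R 2] : ∀ {N : ℕ} (W : Matrix (Fin N) (Fin N) R), Even N →
    pfaffian (Matrix.of fun i j => W i j + 1) = matchingSum W
  | 0, W, _ => by
      rw [Literature.LinearAlgebra.Matrix.pfaffian_fin_zero, matchingSum]
      have h1 : (1 : Perm (Fin 0)) ∈ invols 0 := by simp [invols]
      rw [Finset.sum_eq_single_of_mem 1 h1 (fun σ _ hσ => absurd (Subsingleton.elim σ 1) hσ)]
      simp [involWeight]
  | 1, _, h => absurd h (by decide)
  | n + 2, W, h => by
      classical
      have hn : Even n := by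
        obtain ⟨m, hm⟩ := h
        exact ⟨m - 1, by omega⟩
      -- the Laplace-type expansion along vertex `0`, with the minors evaluated by induction
      rw [pfaffian_fin_add_two]
      have hminor : ∀ j : Fin (n + 1), pfaffian (pfMinor (Matrix.of fun i j => W i j + 1) j) =
          matchingSum (W.submatrix (emb j) (emb j)) := by
        intro j
        exact pfaffian_of_add_one (W.submatrix (emb j) (emb j)) hn
      simp only [hminor, CharTwo.neg_eq, one_pow, one_mul, Matrix.of_apply]
      -- split the involutions of `Fin (n+2)` by whether they fix `0`
      rw [matchingSum, ← Finset.sum_filter_add_sum_filter_not (invols (n + 2)) (fun σ => σ 0 = 0)]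
      simp only [add_mul, one_mul, Finset.sum_add_distrib]
      rw [add_comm]
      congr 1
      · -- PART B: `0` unmatched
        have hperj : ∀ j : Fin (n + 1), matchingSum (W.submatrix (emb j) (emb j)) =
            ∑ σ ∈ (invols (n + 2)).filter (fun σ => σ 0 = 0),
              if σ j.succ = j.succ then involWeight W σ else 0 := by
          intro j
          rw [matchingSum, ← Finset.sum_filter]
          refine Finset.sum_bij' (fun τ _ => ext j τ) (fun σ _ => res j σ) ?_ ?_ ?_ ?_ ?_
          · intro τ hτ
            refine Finset.mem_filter.2 ⟨Finset.mem_filter.2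
              ⟨mem_invols.2 ((ext_invol_iff j τ).2 (mem_invols.1 hτ)), ext_zero j τ⟩, ext_succ j τ⟩
          · intro σ hσ
            obtain ⟨hσ', hσj⟩ := Finset.mem_filter.1 hσ
            obtain ⟨hσi, hσ0⟩ := Finset.mem_filter.1 hσ'
            rw [mem_invols] at hσi
            have haway : ∀ x, Away j (σ x) ↔ Away j x := by
              intro x
              simp only [Away]
              constructor
              · rintro ⟨h1, h2⟩
                refine ⟨fun hx => h1 ?_, fun hx => h2 ?_⟩
                · rw [hx, hσ0]
                · rw [hx, hσj]
              · rintro ⟨h1, h2⟩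
                refine ⟨fun hx => h1 ?_, fun hx => h2 ?_⟩
                · exact σ.injective (hx.trans hσ0.symm)
                · exact σ.injective (hx.trans hσj.symm)
            refine mem_invols.2 fun a => emb_injective j ?_
            rw [emb_res j haway, emb_res j haway, hσi]
          · intro τ hτ
            rw [res_ext]
          · intro σ hσ
            obtain ⟨hσ', hσj⟩ := Finset.mem_filter.1 hσ
            obtain ⟨hσi, hσ0⟩ := Finset.mem_filter.1 hσ'
            have haway : ∀ x, Away j (σ x) ↔ Away j x := by
              intro x
              simp only [Away]
              constructor
              · rintro ⟨h1, h2⟩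
                refine ⟨fun hx => h1 ?_, fun hx => h2 ?_⟩
                · rw [hx, hσ0]
                · rw [hx, hσj]
              · rintro ⟨h1, h2⟩
                refine ⟨fun hx => h1 ?_, fun hx => h2 ?_⟩
                · exact σ.injective (hx.trans hσ0.symm)
                · exact σ.injective (hx.trans hσj.symm)
            have h₂ : ∀ x, σ x ≠ x → Away j x := by
              intro x hx
              refine ⟨fun h' => hx ?_, fun h' => hx ?_⟩
              · rw [h', hσ0]
              · rw [h', hσj]
            rw [ext_res j haway h₂]
          · intro τ hτ
            rw [involWeight_ext]
        simp_rw [hperj]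
        rw [Finset.sum_comm]
        refine Finset.sum_congr rfl fun σ hσ => ?_
        obtain ⟨hσi, hσ0⟩ := Finset.mem_filter.1 hσ
        rw [← Finset.sum_filter, Finset.sum_const, nsmul_eq_mul,
          natCast_eq_one_of_odd (odd_card_fixed_succ hn σ (mem_invols.1 hσi) hσ0), one_mul]

      · -- PART A: `0` matched with `j.succ`
        -- regroup the involutions moving `0` by the value `σ 0 = j.succ`
        have hregroup : ∑ σ ∈ (invols (n + 2)).filter (fun σ => ¬ σ 0 = 0), involWeight W σ =
            ∑ j : Fin (n + 1), ∑ σ ∈ (invols (n + 2)).filter (fun σ => σ 0 = j.succ),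
              involWeight W σ := by
          have hinner : ∀ j : Fin (n + 1),
              ∑ σ ∈ (invols (n + 2)).filter (fun σ => σ 0 = j.succ), involWeight W σ =
                ∑ σ ∈ (invols (n + 2)).filter (fun σ => ¬ σ 0 = 0),
                  if σ 0 = j.succ then involWeight W σ else 0 := by
            intro j
            rw [Finset.sum_filter, Finset.sum_filter]
            refine Finset.sum_congr rfl fun σ _ => ?_
            by_cases h1 : σ 0 = j.succ
            · simp [h1, Fin.succ_ne_zero]
            · simp [h1]
          simp_rw [hinner]
          rw [Finset.sum_comm]
          refine Finset.sum_congr rfl fun σ hσ => ?_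
          have h0 : σ 0 ≠ 0 := (Finset.mem_filter.1 hσ).2
          obtain ⟨y, hy⟩ := (Fin.exists_succ_eq (x := σ 0)).2 h0
          rw [← hy]
          simp [Fin.succ_inj]
        rw [hregroup]
        refine Finset.sum_congr rfl fun j _ => ?_
        rw [matchingSum, Finset.mul_sum]
        -- the bijection `τ ↦ swap 0 j.succ * ext j τ`
        refine Finset.sum_bij' (fun τ _ => swap 0 j.succ * ext j τ)
          (fun σ _ => res j (swap 0 j.succ * σ)) ?_ ?_ ?_ ?_ ?_
        · intro τ hτ
          refine Finset.mem_filter.2 ⟨mem_invols.2 ((swap_mul_ext_invol_iff j τ).2 (mem_invols.1 hτ)),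
            ?_⟩
          simp [Perm.mul_apply]
        · intro σ hσ
          obtain ⟨hσi, hσ0⟩ := Finset.mem_filter.1 hσ
          rw [mem_invols] at hσi
          have hσj : σ j.succ = 0 := by rw [← hσ0, hσi]
          -- `σ' = swap 0 j.succ * σ` fixes `0`, `j.succ`, preserves `Away j`, and is an involution on
          -- the image of `emb j`
          have hfix0 : (swap 0 j.succ * σ) 0 = 0 := by rw [Perm.mul_apply, hσ0, swap_apply_right]
          have hfixj : (swap 0 j.succ * σ) j.succ = j.succ := by
            rw [Perm.mul_apply, hσj, swap_apply_left]
          have haway : ∀ x, Away j ((swap 0 j.succ * σ) x) ↔ Away j x := by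
            intro x
            simp only [Away]
            constructor
            · rintro ⟨h1, h2⟩
              refine ⟨fun hx => h1 ?_, fun hx => h2 ?_⟩
              · rw [hx, hfix0]
              · rw [hx, hfixj]
            · rintro ⟨h1, h2⟩
              refine ⟨fun hx => h1 ?_, fun hx => h2 ?_⟩
              · exact (swap 0 j.succ * σ).injective (hx.trans hfix0.symm)
              · exact (swap 0 j.succ * σ).injective (hx.trans hfixj.symm)
          refine mem_invols.2 fun a => emb_injective j ?_
          rw [emb_res j haway, emb_res j haway]
          -- on `Away j` points `swap 0 j.succ * σ` agrees with `σ`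
          have hagree : ∀ x, Away j x → (swap 0 j.succ * σ) x = σ x := by
            intro x hx
            rw [Perm.mul_apply]
            refine swap_apply_of_ne_of_ne ?_ ?_
            · intro h'; exact hx.2 (by rw [← hσi x, h', hσ0])
            · intro h'; exact hx.1 (by rw [← hσi x, h', hσj])
          have hx : Away j (emb j a) := away_emb j a
          have h1 : (swap 0 j.succ * σ) (emb j a) = σ (emb j a) := hagree _ hx
          have h2 : Away j (σ (emb j a)) := h1 ▸ (haway _).2 hx
          rw [h1, hagree _ h2, hσi]
        · intro τ hτ
          rw [swap_mul_self_mul, res_ext]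
        · intro σ hσ
          obtain ⟨hσi, hσ0⟩ := Finset.mem_filter.1 hσ
          rw [mem_invols] at hσi
          have hσj : σ j.succ = 0 := by rw [← hσ0, hσi]
          have hfix0 : (swap 0 j.succ * σ) 0 = 0 := by rw [Perm.mul_apply, hσ0, swap_apply_right]
          have hfixj : (swap 0 j.succ * σ) j.succ = j.succ := by
            rw [Perm.mul_apply, hσj, swap_apply_left]
          have haway : ∀ x, Away j ((swap 0 j.succ * σ) x) ↔ Away j x := by
            intro x
            simp only [Away]
            constructor
            · rintro ⟨h1, h2⟩
              refine ⟨fun hx => h1 ?_, fun hx => h2 ?_⟩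
              · rw [hx, hfix0]
              · rw [hx, hfixj]
            · rintro ⟨h1, h2⟩
              refine ⟨fun hx => h1 ?_, fun hx => h2 ?_⟩
              · exact (swap 0 j.succ * σ).injective (hx.trans hfix0.symm)
              · exact (swap 0 j.succ * σ).injective (hx.trans hfixj.symm)
          have h₂ : ∀ x, (swap 0 j.succ * σ) x ≠ x → Away j x := by
            intro x hx
            refine ⟨fun h' => hx ?_, fun h' => hx ?_⟩
            · rw [h', hfix0]
            · rw [h', hfixj]
          rw [ext_res j haway h₂, swap_mul_self_mul]
        · intro τ hτ
          rw [involWeight_swap_mul_ext]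

/-! ### The bipartite specialization: `pf (malodMatrix B) = per* B` -/

section Bipartite

open Literature.Barriers.ValiantsHypothesis.GKKP2011Lemma8 (toPartial ofPartial mapWt IsCrossing
  partialPermanent_eq isPartialInjective_toPartial ofPartial_apply matchFun_inl_of_some
  matchFun_inl_of_none matchFun_inr_of_some matchFun_inr_of_none matchFun_involutive)

variable {n : ℕ}

/-- The vertex numbering of the complete bipartite graph `K_{n,n}`: rows `r_i ↦ i`, columns
`c_j ↦ n + j` (`finSumFinEquiv`). [cite: GrenetEtAl2011, Lemma 8 (proof)] -/
abbrev vx (n : ℕ) : Fin n ⊕ Fin n ≃ Fin (n + n) := finSumFinEquiv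

/-- Rows are numbered before columns. [folklore] -/
private theorem vx_inl_lt_vx_inr (i j : Fin n) : vx n (Sum.inl i) < vx n (Sum.inr j) := by
  rw [Fin.lt_def]
  have := i.isLt
  simp
  omega

/-- Columns are not numbered before rows. [folklore] -/
private theorem not_vx_inr_lt_vx_inl (i j : Fin n) : ¬ vx n (Sum.inr j) < vx n (Sum.inl i) :=
  fun h => lt_asymm h (vx_inl_lt_vx_inr i j)

/-- The row numbering is increasing. [folklore] -/
private theorem vx_inl_lt_vx_inl_iff (i i' : Fin n) : vx n (Sum.inl i) < vx n (Sum.inl i') ↔ i < i' := by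
  rw [Fin.lt_def, Fin.lt_def]
  simp

/-- The column numbering is increasing. [folklore] -/
private theorem vx_inr_lt_vx_inr_iff (j j' : Fin n) : vx n (Sum.inr j) < vx n (Sum.inr j') ↔ j < j' := by
  rw [Fin.lt_def, Fin.lt_def]
  simp

/-- **The matrix of Malod–Mengel–Valiant for the partial permanent in characteristic `2`:**
on the `2n` vertices of `K_{n,n}` (rows first), the symmetric matrix with zero diagonal whose
entry at two distinct vertices is `(weight of the edge of K_{n,n} between them, else 0) + 1`,
i.e. `[[J − I, B + J], [Bᵀ + J, J − I]]`. In characteristic `2` it is alternating and its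
Pfaffian is `per* B` (`pfaffian_malodMatrix`); it is Valiant's Pfaffian-Sum matrix
`Θ_B + Λ(1, …, 1)` [Val02] with all signs dropped. Proof plumbing (one definition) for the
theorems below. [cite: GrenetEtAl2011, §5 (postscript: [Mal11], Mengel via [Val02])] -/
def malodMatrix (B : Matrix (Fin n) (Fin n) R) : Matrix (Fin (n + n)) (Fin (n + n)) R :=
  Matrix.of fun x y =>
    (Matrix.fromBlocks 0 B Bᵀ 0) ((vx n).symm x) ((vx n).symm y) + if x = y then 0 else 1

/-- Entries of `malodMatrix B`. [cite: GrenetEtAl2011, §5 (postscript)] -/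
theorem malodMatrix_apply (B : Matrix (Fin n) (Fin n) R) (x y : Fin (n + n)) :
    malodMatrix B x y =
      (Matrix.fromBlocks 0 B Bᵀ 0) ((vx n).symm x) ((vx n).symm y) + if x = y then 0 else 1 := rfl

/-- `malodMatrix B` has zero diagonal. [cite: GrenetEtAl2011, §5 (postscript)] -/
theorem malodMatrix_apply_self (B : Matrix (Fin n) (Fin n) R) (x : Fin (n + n)) :
    malodMatrix B x x = 0 := by
  rw [malodMatrix_apply, if_pos rfl, add_zero]
  rcases h : (vx n).symm x with i | j <;> simp

/-- `malodMatrix B` is symmetric. [cite: GrenetEtAl2011, §5 (postscript)] -/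
theorem malodMatrix_transpose (B : Matrix (Fin n) (Fin n) R) : (malodMatrix B)ᵀ = malodMatrix B := by
  ext x y
  rw [Matrix.transpose_apply, malodMatrix_apply, malodMatrix_apply]
  congr 1
  · rcases hx : (vx n).symm x with i | j <;> rcases hy : (vx n).symm y with i' | j' <;> simp
  · simp [eq_comm]

/-- In characteristic `2`, `malodMatrix B` is alternating (`Mᵀ = −M` with zero diagonal).
[cite: GrenetEtAl2011, §5 (postscript)] -/
theorem malodMatrix_transpose_eq_neg [CharP R 2] (B : Matrix (Fin n) (Fin n) R) :
    (malodMatrix B)ᵀ = -malodMatrix B := by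
  rw [malodMatrix_transpose]
  ext x y
  rw [Matrix.neg_apply, CharTwo.neg_eq]

/-- The weight product of a permutation `ρ` of the vertices of `K_{n,n}` in the bipartite weight
matrix `[[0, B], [Bᵀ, 0]]`, positions `v` with `vx v < vx (ρ v)`. [cite: GrenetEtAl2011, Lemma 8 (proof)] -/
private theorem involWeight_permCongr (B : Matrix (Fin n) (Fin n) R) (ρ : Perm (Fin n ⊕ Fin n)) :
    involWeight ((Matrix.fromBlocks 0 B Bᵀ 0).submatrix (vx n).symm (vx n).symm)
        ((vx n).permCongr ρ) =
      ∏ v : Fin n ⊕ Fin n,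
        if vx n v < vx n (ρ v) then (Matrix.fromBlocks 0 B Bᵀ 0) v (ρ v) else 1 := by
  rw [involWeight]
  symm
  refine Fintype.prod_equiv (vx n) _ _ fun v => ?_
  simp [Equiv.permCongr_apply]

/-- For a crossing involution (a partial matching of `K_{n,n}`) the weight product is the weight
`∏_{i ∈ def π} B i (π i)` of its partial injective map. [cite: GrenetEtAl2011, Lemma 8 (proof)] -/
private theorem prod_vx_eq_mapWt (B : Matrix (Fin n) (Fin n) R) {ρ : Perm (Fin n ⊕ Fin n)}
    (hc : IsCrossing ρ) :
    (∏ v : Fin n ⊕ Fin n,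
        if vx n v < vx n (ρ v) then (Matrix.fromBlocks 0 B Bᵀ 0) v (ρ v) else 1) =
      mapWt B (toPartial ρ) := by
  rw [Fintype.prod_sum_type, mapWt]
  have hcol : (∏ j : Fin n, if vx n (Sum.inr j) < vx n (ρ (Sum.inr j))
      then (Matrix.fromBlocks 0 B Bᵀ 0) (Sum.inr j) (ρ (Sum.inr j)) else 1) = 1 := by
    refine Finset.prod_eq_one fun j _ => ?_
    rcases h : ρ (Sum.inr j) with i | j'
    · rw [if_neg (not_vx_inr_lt_vx_inl i j)]
    · have hfix : j' = j := by
        rcases hc (Sum.inr j) with h1 | h1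
        · rw [h] at h1; exact Sum.inr_injective h1
        · rw [h] at h1; exact absurd rfl h1
      subst hfix
      simp
  rw [hcol, mul_one]
  refine Finset.prod_congr rfl fun i _ => ?_
  rcases h : ρ (Sum.inl i) with i' | j
  · have hfix : i' = i := by
      rcases hc (Sum.inl i) with h1 | h1
      · rw [h] at h1; exact Sum.inl_injective h1
      · rw [h] at h1; exact absurd rfl h1
    subst hfix
    simp [toPartial, h]
  · rw [if_pos (vx_inl_lt_vx_inr i j)]
    simp [toPartial, h]

/-- A non-crossing involution (one with a same-side `2`-cycle) uses a non-edge: weight `0`.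
[cite: GrenetEtAl2011, Lemma 8 (proof)] -/
private theorem prod_vx_eq_zero (B : Matrix (Fin n) (Fin n) R) {ρ : Perm (Fin n ⊕ Fin n)}
    (hρ : ∀ v, ρ (ρ v) = v) (hc : ¬ IsCrossing ρ) :
    (∏ v : Fin n ⊕ Fin n,
        if vx n v < vx n (ρ v) then (Matrix.fromBlocks 0 B Bᵀ 0) v (ρ v) else 1) = 0 := by
  unfold IsCrossing at hc
  push Not at hc
  obtain ⟨v, hv, hside⟩ := hc
  rcases v with i | j
  · rcases h : ρ (Sum.inl i) with i' | j₀
    · have hne : i ≠ i' := fun hii => hv (by rw [h, hii])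
      rcases lt_or_gt_of_ne hne with hlt | hlt
      · refine Finset.prod_eq_zero (Finset.mem_univ (Sum.inl i)) ?_
        rw [h, if_pos ((vx_inl_lt_vx_inl_iff i i').2 hlt)]
        simp
      · refine Finset.prod_eq_zero (Finset.mem_univ (Sum.inl i')) ?_
        have h' : ρ (Sum.inl i') = Sum.inl i := by rw [← h, hρ]
        rw [h', if_pos ((vx_inl_lt_vx_inl_iff i' i).2 hlt)]
        simp
    · rw [h] at hside; exact absurd hside (by simp)
  · rcases h : ρ (Sum.inr j) with i₀ | j'
    · rw [h] at hside; exact absurd hside (by simp)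
    · have hne : j ≠ j' := fun hjj => hv (by rw [h, hjj])
      rcases lt_or_gt_of_ne hne with hlt | hlt
      · refine Finset.prod_eq_zero (Finset.mem_univ (Sum.inr j)) ?_
        rw [h, if_pos ((vx_inr_lt_vx_inr_iff j j').2 hlt)]
        simp
      · refine Finset.prod_eq_zero (Finset.mem_univ (Sum.inr j')) ?_
        have h' : ρ (Sum.inr j') = Sum.inr j := by rw [← h, hρ]
        rw [h', if_pos ((vx_inr_lt_vx_inr_iff j' j).2 hlt)]
        simp

/-- The crossing involutions of `m ⊔ m` are in bijection with the injective partial maps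
`m ⇀ m` (proof of GKKP Lemma 8: "a cycle cover with such cycles actually is a partial matching"),
and the bijection matches `mapWt`. Generic in the index type (as in `GKKP2011Lemma8`).
[cite: GrenetEtAl2011, Lemma 8 (proof)] -/
theorem sum_crossing_mapWt_toPartial {m : Type} [Fintype m] [DecidableEq m] (B : Matrix m m R) :
    ∑ ρ ∈ ((univ : Finset (Perm (m ⊕ m))).filter (fun ρ => ∀ v, ρ (ρ v) = v)).filter
        (fun ρ => IsCrossing ρ), mapWt B (toPartial ρ) = B.partialPermanent := by
  classical
  rw [partialPermanent_eq]
  set S := (univ : Finset (Perm (m ⊕ m))).filter (fun ρ => ∀ v, ρ (ρ v) = v) with hS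
  have hinv : ∀ ρ ∈ S, ∀ v, ρ (ρ v) = v := fun ρ hρ => (Finset.mem_filter.1 hρ).2
  -- crossing involutions ↔ injective partial maps (as in the proof of GKKP Lemma 8)
  refine Finset.sum_nbij' toPartial ofPartial (fun ρ _ => ?_) (fun π hπ => ?_) (fun ρ hρ => ?_)
    (fun π hπ => ?_) (fun ρ _ => rfl)
  · exact Finset.mem_filter.2 ⟨Finset.mem_univ _, isPartialInjective_toPartial ρ⟩
  · have hπ' : Matrix.IsPartialInjective π := (Finset.mem_filter.1 hπ).2
    refine Finset.mem_filter.2 ⟨Finset.mem_filter.2 ⟨Finset.mem_univ _, fun v => ?_⟩, fun v => ?_⟩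
    · rw [ofPartial_apply hπ', ofPartial_apply hπ', matchFun_involutive hπ' v]
    · rw [ofPartial_apply hπ']
      rcases v with i | j
      · rcases h : π i with _ | j
        · exact Or.inl (matchFun_inl_of_none h)
        · exact Or.inr (by rw [matchFun_inl_of_some h]; simp)
      · by_cases hex : ∃ i, π i = some j
        · obtain ⟨i, hi⟩ := hex
          exact Or.inr (by rw [matchFun_inr_of_some hπ' hi]; simp)
        · exact Or.inl (matchFun_inr_of_none fun i hi => hex ⟨i, hi⟩)
  · -- `ofPartial (toPartial ρ) = ρ`
    have hρS : ρ ∈ S := (Finset.mem_filter.1 hρ).1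
    have hc : IsCrossing ρ := (Finset.mem_filter.1 hρ).2
    have hπ' := isPartialInjective_toPartial ρ
    refine Equiv.ext fun v => ?_
    rw [ofPartial_apply hπ']
    rcases v with i | j
    · rcases h : ρ (Sum.inl i) with i' | j₀
      · have hfix : i' = i := by
          rcases hc (Sum.inl i) with h1 | h1
          · rw [h] at h1; exact Sum.inl_injective h1
          · rw [h] at h1; exact absurd rfl h1
        rw [hfix] at h ⊢
        rw [matchFun_inl_of_none (π := toPartial ρ) (i := i) (by simp [toPartial, h])]
      · rw [matchFun_inl_of_some (π := toPartial ρ) (i := i) (j := j₀) (by simp [toPartial, h])]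
    · rcases h : ρ (Sum.inr j) with i₀ | j'
      · have hi₀ : toPartial ρ i₀ = some j := by
          have := hinv ρ hρS (Sum.inr j)
          rw [h] at this
          simp [toPartial, this]
        rw [matchFun_inr_of_some hπ' hi₀]
      · have hfix : j' = j := by
          rcases hc (Sum.inr j) with h1 | h1
          · rw [h] at h1; exact Sum.inr_injective h1
          · rw [h] at h1; exact absurd rfl h1
        rw [hfix] at h ⊢
        refine matchFun_inr_of_none fun i hi => ?_
        simp only [toPartial, Sum.getRight?_eq_some_iff] at hi
        have := hinv ρ hρS (Sum.inl i)
        rw [hi, h] at this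
        exact Sum.inr_ne_inl this
  · -- `toPartial (ofPartial π) = π`
    have hπ' : Matrix.IsPartialInjective π := (Finset.mem_filter.1 hπ).2
    funext i
    simp only [toPartial, ofPartial_apply hπ']
    rcases h : π i with _ | j
    · rw [matchFun_inl_of_none h]; simp
    · rw [matchFun_inl_of_some h]; simp

/-- **The all-matchings sum of the bipartite weight matrix is the partial permanent**
(GKKP Lemma 7: "the partial permanent of `B` is equal to the sum of the weights of the partial
matchings of `G`"), over every commutative ring. [cite: GrenetEtAl2011, Lemma 7] -/
theorem matchingSum_bipartite (B : Matrix (Fin n) (Fin n) R) :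
    matchingSum ((Matrix.fromBlocks 0 B Bᵀ 0).submatrix (vx n).symm (vx n).symm) =
      B.partialPermanent := by
  classical
  rw [matchingSum, ← sum_crossing_mapWt_toPartial B]
  -- reindex the involutions of `Fin (n+n)` by those of `Fin n ⊕ Fin n`
  set S := (univ : Finset (Perm (Fin n ⊕ Fin n))).filter (fun ρ => ∀ v, ρ (ρ v) = v) with hS
  have hreindex : ∑ σ ∈ invols (n + n),
      involWeight ((Matrix.fromBlocks 0 B Bᵀ 0).submatrix (vx n).symm (vx n).symm) σ =
      ∑ ρ ∈ S, ∏ v : Fin n ⊕ Fin n,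
        if vx n v < vx n (ρ v) then (Matrix.fromBlocks 0 B Bᵀ 0) v (ρ v) else 1 := by
    symm
    refine Finset.sum_equiv (vx n).permCongr (fun ρ => ?_) (fun ρ _ => ?_)
    · rw [hS, Finset.mem_filter, mem_invols]
      simp only [Finset.mem_univ, true_and, Equiv.permCongr_apply, Equiv.symm_apply_apply]
      constructor
      · intro h x
        rw [h, Equiv.apply_symm_apply]
      · intro h v
        simpa using h (vx n v)
    · rw [involWeight_permCongr]
  rw [hreindex]
  -- keep only the crossing involutions (the others weigh `0`), then evaluate their weights
  have hinv : ∀ ρ ∈ S, ∀ v, ρ (ρ v) = v := fun ρ hρ => (Finset.mem_filter.1 hρ).2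
  have step1 : ∑ ρ ∈ S, (∏ v : Fin n ⊕ Fin n,
      if vx n v < vx n (ρ v) then (Matrix.fromBlocks 0 B Bᵀ 0) v (ρ v) else 1) =
      ∑ ρ ∈ S.filter (fun ρ => IsCrossing ρ), ∏ v : Fin n ⊕ Fin n,
        if vx n v < vx n (ρ v) then (Matrix.fromBlocks 0 B Bᵀ 0) v (ρ v) else 1 := by
    refine (Finset.sum_subset (Finset.filter_subset _ S) fun ρ hρS hρIC => ?_).symm
    have hc : ¬ IsCrossing ρ := fun hc => hρIC (Finset.mem_filter.2 ⟨hρS, hc⟩)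
    exact prod_vx_eq_zero B (hinv ρ hρS) hc
  rw [step1]
  exact Finset.sum_congr rfl fun ρ hρ => prod_vx_eq_mapWt B (Finset.mem_filter.1 hρ).2

/-- **`pf (malodMatrix B) = per* B` in characteristic `2`** — the identity behind
"Mengel noticed that [`PER* ∈ VP_ws`] can be derived from a result of Valiant on Pfaffian Sums
[Val02]": the Pfaffian of `Θ_B + Λ(1,…,1)` is the sum over ALL matchings `μ` of `K_{n,n}` of
`w(μ) · (2n − 2|μ| − 1)!!`, and the double factorials are odd. [cite: GrenetEtAl2011, §5 (postscript: [Mal11], Mengel via [Val02])] -/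
theorem pfaffian_malodMatrix [CharP R 2] (B : Matrix (Fin n) (Fin n) R) :
    pfaffian (malodMatrix B) = B.partialPermanent := by
  rw [← matchingSum_bipartite B, ← pfaffian_of_add_one _ ⟨n, rfl⟩]
  refine pfaffian_congr fun x y hxy => ?_
  rw [malodMatrix_apply, Matrix.of_apply, if_neg (ne_of_lt hxy), Matrix.submatrix_apply]

end Bipartite

/-! ### `PER*` is easy in characteristic `2`: layered ABP, determinantal complexity, `VP_ws`,
`p`-projection of `DET` -/

section Assembly

open Literature.Computability.AlgebraicComplexity MvPolynomial

variable (k : Type u) [CommRing k]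

/-- A variable has total degree at most `1` (also over the zero ring). [folklore] -/
private theorem totalDegree_X_le_one {σ : Type*} (s : σ) : (X s : MvPolynomial σ k).totalDegree ≤ 1 := by
  rcases subsingleton_or_nontrivial k with h | h
  · rw [Subsingleton.elim (X s : MvPolynomial σ k) 0, totalDegree_zero]; exact Nat.zero_le _
  · rw [totalDegree_X]

variable {n : ℕ}

/-- The entries of `malodMatrix (X_{ij})` are affine: `x_{ij} + 1`, `1` or `0`.
[cite: GrenetEtAl2011, §5 (postscript)] -/
theorem totalDegree_malodMatrix_X_le (x y : Fin (n + n)) :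
    (malodMatrix (Matrix.mvPolynomialX (Fin n) (Fin n) k) x y).totalDegree ≤ 1 := by
  rw [malodMatrix_apply]
  refine (totalDegree_add _ _).trans (max_le ?_ ?_)
  · rcases hx : (vx n).symm x with i | j <;> rcases hy : (vx n).symm y with i' | j'
    · simp
    · simpa [Matrix.mvPolynomialX_apply] using totalDegree_X_le_one k (i, j')
    · simpa [Matrix.mvPolynomialX_apply] using totalDegree_X_le_one k (i', j)
    · simp
  · split_ifs <;> simp

/-- The Pfaffian is unchanged by relabelling `Fin N ≃ Fin N'` along an equality `N = N'`.
[folklore] -/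
private theorem pfaffian_reindex_finCongr :
    ∀ {N N' : ℕ} (h : N = N') (A : Matrix (Fin N) (Fin N) R),
      pfaffian (Matrix.reindex (finCongr h) (finCongr h) A) = pfaffian A := by
  intro N N' h A
  subst h
  simp [finCongr_refl]

end Assembly

end PartialPermanentCharTwo

/-! ## `PER*` is easy in characteristic `2`: layered ABP, determinantal complexity, `VP_ws`,
`p`-projection of `DET` (headline statements) -/

section Headline

open Literature.Computability.AlgebraicComplexity MvPolynomial PartialPermanentCharTwo
open Literature.LinearAlgebra.Matrix (pfaffian)

universe u

variable (k : Type u) [CommRing k]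

/-- **A layered ABP with `2(n+2)³` vertices for `PER*_{n+1}` in characteristic `2`**: the
layered Pfaffian program of `PfaffianLayeredABP.lean` (Rote's recursion, every alternating matrix
with affine entries) run on `malodMatrix (X_{ij})`, whose Pfaffian is `PER*_{n+1}`
(`pfaffian_malodMatrix`) — Mengel's derivation of [Mal11] from Valiant's Pfaffian Sum theorem,
with the Pfaffian evaluated by a branching program [MSV04, Thm. 12].
[cite: GrenetEtAl2011, §5 (postscript: [Mal11], Mengel via [Val02])] -/
theorem layeredABPComputes_partialPerPoly_succ_of_charTwo [CharP k 2] (n : ℕ) :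
    LayeredABPComputes (2 * (n + 2) ^ 3) (partialPerPoly (Fin (n + 1)) k) := by
  have hN : (n + 1) + (n + 1) = 2 * n + 2 := by ring
  have h := PfaffianABP.layeredABPComputes_of_alternating n
    (Matrix.reindex (finCongr hN) (finCongr hN)
      (malodMatrix (Matrix.mvPolynomialX (Fin (n + 1)) (Fin (n + 1)) k))) ?_ ?_ ?_
  · rwa [pfaffian_reindex_finCongr, pfaffian_malodMatrix, ← partialPerPoly_def] at h
  · rw [Matrix.transpose_reindex, malodMatrix_transpose_eq_neg]
    exact Matrix.ext fun x y => by simp [Matrix.reindex_apply]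
  · intro i
    rw [Matrix.reindex_apply, Matrix.submatrix_apply, malodMatrix_apply_self]
  · intro a b
    rw [Matrix.reindex_apply, Matrix.submatrix_apply]
    exact totalDegree_malodMatrix_X_le k _ _

/-- **`dc (PER*_n) ≤ 2 (n+1)³ + 1` in characteristic `2`, as an affine determinantal
representation** (every commutative ring of characteristic `2`; `n = 0`: `PER*_0 = 1`).
[cite: GrenetEtAl2011, §5 (postscript: [Mal11], Mengel via [Val02])] -/
theorem hasDetRepr_partialPerPoly_of_charTwo [CharP k 2] (n : ℕ) :
    HasDetRepr (partialPerPoly (Fin n) k) (2 * (n + 1) ^ 3 + 1) := by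
  cases n with
  | zero =>
    rw [partialPerPoly_of_isEmpty]
    exact HasDetRepr.mono_holds
      (HasInvRepr.of_totalDegree_le_one (a := (1 : MvPolynomial (Fin 0 × Fin 0) k))
        (by simp)).hasDetRepr (by norm_num)
  | succ n => exact (layeredABPComputes_partialPerPoly_succ_of_charTwo k n).hasDetRepr

/-- **`dc (PER*_n) ≤ 2 (n+1)³ + 1`** in characteristic `2`.
[cite: GrenetEtAl2011, §5 (postscript: [Mal11], Mengel via [Val02])] -/
theorem determinantalComplexity_partialPerPoly_le_of_charTwo [CharP k 2] (n : ℕ) :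
    determinantalComplexity (partialPerPoly (Fin n) k) ≤ 2 * (n + 1) ^ 3 + 1 :=
  determinantalComplexity_le_of_hasDetRepr (hasDetRepr_partialPerPoly_of_charTwo k n)

/-- The determinantal complexity of `(PER*_n)` is polynomially bounded in characteristic `2`.
[cite: GrenetEtAl2011, §5 (postscript: [Mal11], Mengel via [Val02])] -/
theorem isPBounded_determinantalComplexity_partialPerPoly_of_charTwo [CharP k 2] :
    IsPBounded fun n => determinantalComplexity (partialPerPoly (Fin n) k) := by
  have hN : IsPBounded fun n => 2 * (n + 1) ^ 3 + 1 :=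
    IsPBounded.add_holds (IsPBounded.mul_holds (IsPBounded.const 2)
      (IsPBounded.pow_holds (IsPBounded.add_holds IsPBounded.id (IsPBounded.const 1)) 3))
      (IsPBounded.const 1)
  exact hN.mono fun n => determinantalComplexity_partialPerPoly_le_of_charTwo k n

/-- **`L_ws(f) ≤ ((N+2)(4N³+7)² + N²)·(2·#σ + 3)` whenever `f` has an affine determinantal
representation of size `N`**, over every commutative ring (the tree's
`wsComplexity_le_of_hasDetRepr` is the case `k = ℂ`; same proof: substitute the affine entries
into the tree's skew determinant circuit, `wsComplexity_aeval_affine_le`).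
[cite: BurgisserEtAl2011, §9.1–§9.2 (det ∈ VP_ws; universality of the determinant)] -/
theorem wsComplexity_le_of_hasDetRepr_commRing {σ : Type*} [Fintype σ] [DecidableEq σ]
    {f : MvPolynomial σ k} {N : ℕ} (h : HasDetRepr f N) :
    wsComplexity f ≤ ((N + 2) * (4 * N ^ 3 + 7) ^ 2 + N * N) * (2 * Fintype.card σ + 3) := by
  classical
  obtain ⟨A, hAdeg, hAdet⟩ := h
  -- the affine substitution data
  set a0 : Fin N × Fin N → k := fun ij => coeff 0 (A ij.1 ij.2) with ha0
  set Ac : Fin N × Fin N → σ → k := fun ij t => coeff (Finsupp.single t 1) (A ij.1 ij.2) with hAc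
  have hentry : ∀ ij : Fin N × Fin N, ArithCircuit.SkewSubst.psi a0 Ac ij = A ij.1 ij.2 := by
    intro ij
    rw [ArithCircuit.SkewSubst.psi, ha0, hAc]
    conv_rhs => rw [DeterminantalConormal.eq_C_add_sum_of_totalDegree_le_one (hAdeg ij.1 ij.2)]
    simp only [smul_eq_C_mul]
  have hpsi : ArithCircuit.SkewSubst.psi a0 Ac = fun p : Fin N × Fin N => A p.1 p.2 :=
    funext hentry
  have hf : f = aeval (ArithCircuit.SkewSubst.psi a0 Ac) (detPoly (Fin N) k) := by
    rw [hpsi, detPoly, AlgHom.map_det, Matrix.mvPolynomialX_mapMatrix_aeval, hAdet]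
  rw [hf]
  refine (wsComplexity_aeval_affine_le a0 Ac _).trans ?_
  have hc : Fintype.card (Fin N × Fin N) = N * N := by simp
  rw [hc]
  exact Nat.mul_le_mul_right _ (Nat.add_le_add_right (skewComplexity_detPoly_le k N) _)

/-- **Malod's theorem [Mal11]: `PER* ∈ VP_ws` in characteristic `2`** (GKKP 2011 §5,
postscript: "Bürgisser's open problem [Problem 3.1: is the partial permanent `VNP`-complete in
characteristic `2`?] has been completely settled. Guillaume Malod has proved, using clow sequences
à la Mahajan and Vinay, that `PER* ∈ VP_ws`. Stefan Mengel subsequently noticed that the result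
can be derived from a result of Valiant on Pfaffian Sums [Val02]"), in the tree's `VP_ws`
(`IsVPwsFamily`, BLMW 2011 §9.1, well-formed fan-in-two weakly-skew circuits), over every
commutative ring of characteristic `2`. Route: Mengel's (Pfaffian), kernel-checked.
[cite: GrenetEtAl2011, §5 (postscript: [Mal11], Mengel via [Val02])] -/
theorem isVPwsFamily_partialPerPoly_of_charTwo [CharP k 2] :
    IsVPwsFamily fun n => partialPerPoly (Fin n) k := by
  have hN : IsPBounded fun n => 2 * (n + 1) ^ 3 + 1 :=
    IsPBounded.add_holds (IsPBounded.mul_holds (IsPBounded.const 2)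
      (IsPBounded.pow_holds (IsPBounded.add_holds IsPBounded.id (IsPBounded.const 1)) 3))
      (IsPBounded.const 1)
  have hT : IsPBounded fun n => (((2 * (n + 1) ^ 3 + 1) + 2) * (4 * (2 * (n + 1) ^ 3 + 1) ^ 3 + 7) ^ 2
      + (2 * (n + 1) ^ 3 + 1) * (2 * (n + 1) ^ 3 + 1)) * (2 * (n * n) + 3) :=
    IsPBounded.mul_holds
      (IsPBounded.add_holds
        (IsPBounded.mul_holds (IsPBounded.add_holds hN (IsPBounded.const 2))
          (IsPBounded.pow_holds (IsPBounded.add_holds (IsPBounded.mul_holds (IsPBounded.const 4)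
            (IsPBounded.pow_holds hN 3)) (IsPBounded.const 7)) 2))
        (IsPBounded.mul_holds hN hN))
      (IsPBounded.add_holds (IsPBounded.mul_holds (IsPBounded.const 2)
        (IsPBounded.mul_holds IsPBounded.id IsPBounded.id)) (IsPBounded.const 3))
  refine hT.mono fun n => ?_
  have h := wsComplexity_le_of_hasDetRepr_commRing k (hasDetRepr_partialPerPoly_of_charTwo k n)
  have hcard : Fintype.card (Fin n × Fin n) = n * n := by simp
  rw [hcard] at h
  exact h

/-- **`(PER*_n)` is a `p`-projection of `(DET_n)` in characteristic `2`** — the rendering of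
"`PER* ∈ VP_ws`" used for Thm. 8 / Cor. 1 in `GKKP11CharacteristicTwo.lean` (Malod–Portier:
`VP_ws` = `p`-projections of the determinant): a size-optimal well-formed fan-in-two skew circuit
for `PER*_n` (`skewComplexity_attained`, `L_skew ≤ 4 L_ws`) is read as a projection of
`DET_{3s+1}` (`isProjection_detPoly_of_isSkew`). Every commutative ring of characteristic `2`.
[cite: GrenetEtAl2011, §5 (postscript: [Mal11], Mengel via [Val02])] -/
theorem isPProjection_partialPerPoly_detPoly_of_charTwo [CharP k 2] :
    IsPProjection (fun n => partialPerPoly (Fin n) k) (fun n => detPoly (Fin n) k) := by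
  classical
  choose P _ h2 hsk hcomp hsize using fun n =>
    HI16Skew.skewComplexity_attained (partialPerPoly (Fin n) k)
  refine ⟨fun n => 3 * (P n).size + 1, ?_, fun n => ?_⟩
  · obtain ⟨d, hd⟩ := isVPwsFamily_partialPerPoly_of_charTwo k
    have hpoly : IsPBounded fun n => 3 * (4 * (n ^ d + d)) + 1 :=
      IsPBounded.add_holds (IsPBounded.mul_holds (IsPBounded.const 3)
        (IsPBounded.mul_holds (IsPBounded.const 4) ⟨d, fun n => le_rfl⟩)) (IsPBounded.const 1)
    refine hpoly.mono fun n => ?_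
    have h1 : (P n).size ≤ 4 * (n ^ d + d) :=
      (hsize n).le.trans ((ArithCircuit.skewComplexity_le_four_mul_wsComplexity _).trans
        (Nat.mul_le_mul_left 4 (hd n)))
    exact Nat.add_le_add_right (Nat.mul_le_mul_left 3 h1) 1
  · have h := HI16Skew.isProjection_detPoly_of_isSkew (P n) (h2 n) (hsk n)
    have he : (P n).eval = partialPerPoly (Fin n) k := hcomp n
    rwa [he] at h

/-- **GKKP Corollary 1 without the square**: over a commutative ring of characteristic `2`, if
`(PER*_n)` is `VNP`-complete then EVERY `VNP` family is a `p`-projection of `(DET_n)`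
("`VNP ⊆ VP_ws`"; GKKP Cor. 1 obtained `VNP² ⊆ VP_ws` from Thm. 8, before [Mal11]).
[cite: GrenetEtAl2011, Cor 1 and §5 (postscript: [Mal11])] -/
theorem isPProjection_detPoly_of_isVNPComplete_partialPerPoly [CharP k 2]
    (hc : IsVNPComplete fun n => partialPerPoly (Fin n) k) (v : ℕ → ℕ)
    (f : ∀ n, MvPolynomial (Fin (v n)) k) (hf : IsVNPFamily f) :
    IsPProjection f (fun n => detPoly (Fin n) k) :=
  IsPProjection.trans_holds (hc.2 v f hf) (isPProjection_partialPerPoly_detPoly_of_charTwo k)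

/-- **`(PER*_n) ∈ VP` in characteristic `2`** (from `VP_ws ⊆ VP`, BLMW 2011 §9.1, tree
`IsVPwsFamily.isVPFamily`: the number of variables `n²` is p-bounded and the degree of a weakly-skew
circuit is bounded by its size) — the reading of [Mal11] in Valiant's original class.
[cite: GrenetEtAl2011, §5 (postscript: [Mal11], Mengel via [Val02])] -/
theorem isVPFamily_partialPerPoly_of_charTwo [CharP k 2] :
    IsVPFamily fun n => partialPerPoly (Fin n) k :=
  (isVPwsFamily_partialPerPoly_of_charTwo k).isVPFamily
    ((IsPBounded.mul_holds IsPBounded.id IsPBounded.id).mono fun n => by simp)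

end Headline

end Literature.Barriers.ValiantsHypothesis

end
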